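import Summits.Ventures.LatticeQCDFlow.Scaling.ExchangeOfferCeiling

/-!
HONEST FRAMING: exact (Metropolis-corrected) sampling algorithms for lattice gauge theory; figures
of merit are autocorrelation/cost numbers at stated couplings and volumes; no continuum-physics
claim.

# OfferCeilingLadderAndMaps — THE OFFER CEILING FOR THE ADJACENT LADDER AND FOR THE MAP-ASSISTED STAR: THE TAGLESS
# REPLICA-EXCHANGE SAMPLER IS THE GRAPH SAMPLER ON THE PATH, SO `Gap(ptBareSampler t μ M) ≤ ((t/K)·Σ_{|i−k|=1} μ_i(u)
# + (1−t)μ_k(u)/(K+1))/(μ_k(u)(1−μ_k(u)))` — THE COLDEST REPLICA IS REFRESHED AT `u` NO FASTER THAN ITS NEIGHBOUR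
# OFFERS `u`; WITH MAPS ON THE HUB EDGES `Gap(P^φ) ≤ (t·μ_0(u)/K + (1−t)w_{k+1}μ_{k+1}(φ_k u))/(μ_{k+1}(φ_k u)(1 −
# μ_{k+1}(φ_k u)))` — THE TRANSPORTED RATIO (lean-2 GEN-22, ours)

Venture-side (OURS).  Cell `lqcd-flow` (pub-lqcd), unit `pub-lqcd-lean-2-g22`, 2026-08-26.  Chapter J, file 11:
corollaries of `Scaling/ExchangeOfferCeiling` (J10: an exchange scheme over any swap graph relaxes replica `k` no
faster than its swap partners offer each configuration).  §1 identifies the tagless adjacent sampler of chapter R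
(`Scaling/ReplicaExchangeBareSampler.ptBareSampler`: uniform adjacent Metropolis swap w.p. `t`, one uniformly chosen
replica update w.p. `1−t`) with the graph sampler of `Scaling/ReplicaExchangeGraphSwap` on the PATH `(r, r+1)` with
identity maps, entrywise; §2 reads off the ladder offer ceiling and its closed form at the COLDEST level (indexing
`K+2` levels `0,…,K+1` so that the coldest level `K+1` has the single neighbour `K`); §3 transfers the star's ceiling
to maps on the hub edges by the level coordinates of `Scaling/FlowHubSchemeFloor` (the ratio is taken of the
TRANSPORTED cold law `μ_{k+1}∘φ_k` against the hot law).

## What is proved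

* §1 `ptBareProposal_eq_path`, `ptBareSwap_eq_path`, **`ptBareSampler_eq_path`** (`ptBareSampler t μ M =
  t·ptGraphSwap μ path 1 + (1−t)·prodKernel (K+1)⁻¹ M`).
* §2 **`ptBare_spectralGap_le_offer`** (every level `k`, configuration `u`); `path_offer_coldest`;
  **`ptBare_spectralGap_le_coldest`** — levels `0..K+1`:
  `Gap(ptBareSampler t μ M) ≤ (t·μ_K(u)/(K+1) + (1−t)·μ_{K+1}(u)/(K+2))/(μ_{K+1}(u)(1 − μ_{K+1}(u)))`.
* §3 **`flowStar_spectralGap_le_config`** — maps `φ_k` on the hub edges, any weights: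
  `Gap(P^φ) ≤ (t·μ_0(u)/K + (1−t)·w_{k+1}·μ_{k+1}(φ_k u))/(μ_{k+1}(φ_k u)(1 − μ_{k+1}(φ_k u)))` for every `u`.

Reading (no numerics implied): a ladder pays `K³` (chapters R/H) to replace the hub's global hot-to-cold ratio by
ADJACENT ratios — this file is the pointwise form of that trade: per replica, a ladder is capped by `(t/K)·`(the
neighbours' weight of `u`)`/μ_k(u)`, a hub by `(t/K)·μ_0(u)/μ_{k+1}(u)`, a map-assisted hub by the same with the
transported cold law.  NOT CLAIMED: ladders with maps (conjugate by `Scaling/FlowLadderConjugacy` in the same way);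
anything measured.  Literature grade (cell rule): ELEMENTARY COROLLARIES; nothing cited as a fact; no new bib keys.
-/

noncomputable section

open Finset Function
open Literature.Probability.MarkovChains

namespace Summit.Ventures.LatticeQCDFlow.Scaling

section LadderOffer

variable {S : Type*} [Fintype S] [DecidableEq S] {K : ℕ} {μ : Fin (K + 1) → S → ℝ}
  {M : Fin (K + 1) → S → S → ℝ} {t : ℝ}

/-! ## §1 The tagless adjacent sampler is the graph sampler on the path -/

omit [Fintype S] in
/-- The adjacent proposal is the path-graph proposal with identity maps. [ours] -/
theorem ptBareProposal_eq_path (x y : Fin (K + 1) → S) :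
    ptBareProposal x y
      = ptGraphProposal (fun r : Fin K => (r.castSucc, r.succ)) (fun _ : Fin K => Equiv.refl S) x y := by
  unfold ptBareProposal ptGraphProposal
  refine sum_congr rfl fun r _ => ?_
  have hne : (r.castSucc : Fin (K + 1)) ≠ r.succ := (show r.castSucc < r.succ from Fin.castSucc_lt_succ).ne
  rw [edgeFlowSwap_one hne]
  rfl

/-- The adjacent Metropolis swap is the path-graph swap. [ours] -/
theorem ptBareSwap_eq_path (μ : Fin (K + 1) → S → ℝ) :
    ptBareSwap μ = ptGraphSwap μ (fun r : Fin K => (r.castSucc, r.succ)) (fun _ : Fin K => Equiv.refl S) := by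
  unfold ptBareSwap ptGraphSwap
  have h : (ptBareProposal : (Fin (K + 1) → S) → (Fin (K + 1) → S) → ℝ)
      = ptGraphProposal (fun r : Fin K => (r.castSucc, r.succ)) (fun _ : Fin K => Equiv.refl S) :=
    funext fun x => funext fun y => ptBareProposal_eq_path x y
  rw [h]

/-- **The tagless replica-exchange sampler is the path-graph exchange scheme with uniform weights.** [ours] -/
theorem ptBareSampler_eq_path (t : ℝ) (μ : Fin (K + 1) → S → ℝ) (M : Fin (K + 1) → S → S → ℝ) :
    ptBareSampler t μ M = fun x y : Fin (K + 1) → S =>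
      t * ptGraphSwap μ (fun r : Fin K => (r.castSucc, r.succ)) (fun _ : Fin K => Equiv.refl S) x y
        + (1 - t) * prodKernel (fun _ : Fin (K + 1) => (1 : ℝ) / (K + 1)) M x y := by
  funext x y
  rw [ptBareSampler_apply, ptBareSwap_eq_path]

/-! ## §2 The ladder offer ceiling -/

/-- **THE LADDER OFFER CEILING:** for every level `k` and configuration `u`,
`Gap(ptBareSampler t μ M) ≤ ((t/K)·Σ_r (if k = r then μ_{r+1}(u) else if k = r+1 then μ_r(u) else 0)
  + (1−t)·μ_k(u)/(K+1))/(μ_k(u)(1 − μ_k(u)))` (`0 ≤ t ≤ 1`, `M_k` row-stochastic `μ_k`-reversible, `|S| ≥ 2`). [ours] -/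
theorem ptBare_spectralGap_le_offer [Nontrivial S] (hμ : ∀ k x, 0 < μ k x) (hμ1 : ∀ k, ∑ u, μ k u = 1)
    (hM : ∀ k, IsRowStochastic (M k)) (hMrev : ∀ k, DetailedBalance (μ k) (M k)) (ht0 : 0 ≤ t) (ht1 : t ≤ 1)
    (k : Fin (K + 1)) (u : S) :
    spectralGap (tensorFun μ) (ptBareSampler t μ M)
      ≤ (t / K * ∑ r : Fin K, (if k = r.castSucc then μ r.succ u else if k = r.succ then μ r.castSucc u else 0)
          + (1 - t) * ((1 : ℝ) / (K + 1)) * μ k u) / (μ k u * (1 - μ k u)) := by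
  rw [ptBareSampler_eq_path]
  exact exchange_spectralGap_le_offer (e := fun r : Fin K => (r.castSucc, r.succ))
    (w := fun _ : Fin (K + 1) => (1 : ℝ) / (K + 1)) (fun r => (show r.castSucc < r.succ from Fin.castSucc_lt_succ).ne)
    hμ hμ1 hM hMrev
    (fun _ => by positivity) (sum_uniform_weight K) ht0 ht1 k u

end LadderOffer

section Coldest

variable {S : Type*} [Fintype S] [DecidableEq S] {K : ℕ} {μ : Fin (K + 2) → S → ℝ}
  {M : Fin (K + 2) → S → S → ℝ} {t : ℝ}

omit [Fintype S] [DecidableEq S] in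
/-- On `K+2` levels the coldest level `K+1 = (last K).succ` is offered `u` only by its neighbour `K = (last K).castSucc`.
[ours] -/
theorem path_offer_coldest (μ : Fin (K + 2) → S → ℝ) (u : S) :
    ∑ r : Fin (K + 1), (if (Fin.last K).succ = r.castSucc then μ r.succ u
        else if (Fin.last K).succ = r.succ then μ r.castSucc u else 0)
      = μ (Fin.last K).castSucc u := by
  have h1 : ∀ r : Fin (K + 1), (Fin.last K).succ ≠ r.castSucc := fun r =>
    ne_of_gt (lt_of_le_of_lt (Fin.castSucc_le_castSucc_iff.mpr (Fin.le_last r))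
      (show (Fin.last K).castSucc < (Fin.last K).succ from Fin.castSucc_lt_succ))
  have h2 : ∀ r : Fin (K + 1), (Fin.last K).succ = r.succ ↔ Fin.last K = r := fun r => Fin.succ_inj
  simp_rw [if_neg (h1 _), h2]
  rw [Finset.sum_ite_eq univ (Fin.last K), if_pos (mem_univ _)]

/-- **THE COLDEST REPLICA OF A LADDER IS REFRESHED AT `u` NO FASTER THAN ITS NEIGHBOUR OFFERS `u`:** on `K+2` levels
`0, …, K+1`, for every configuration `u`,
`Gap(ptBareSampler t μ M) ≤ (t·μ_K(u)/(K+1) + (1−t)·μ_{K+1}(u)/(K+2))/(μ_{K+1}(u)(1 − μ_{K+1}(u)))`. [ours] -/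
theorem ptBare_spectralGap_le_coldest [Nontrivial S] (hμ : ∀ k x, 0 < μ k x) (hμ1 : ∀ k, ∑ u, μ k u = 1)
    (hM : ∀ k, IsRowStochastic (M k)) (hMrev : ∀ k, DetailedBalance (μ k) (M k)) (ht0 : 0 ≤ t) (ht1 : t ≤ 1)
    (u : S) :
    spectralGap (tensorFun μ) (ptBareSampler t μ M)
      ≤ (t * μ (Fin.last K).castSucc u / (K + 1) + (1 - t) * μ (Fin.last K).succ u / (K + 2))
          / (μ (Fin.last K).succ u * (1 - μ (Fin.last K).succ u)) := by
  have h := ptBare_spectralGap_le_offer (M := M) hμ hμ1 hM hMrev ht0 ht1 (Fin.last K).succ u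
  rw [path_offer_coldest μ u] at h
  refine h.trans (le_of_eq ?_)
  congr 1
  push_cast
  ring

end Coldest

section FlowStarOffer

variable {S : Type*} [Fintype S] [DecidableEq S] {K : ℕ} {μ : Fin (K + 1) → S → ℝ}
  {M : Fin (K + 1) → S → S → ℝ} {w : Fin (K + 1) → ℝ} {t : ℝ} (φ : Fin K → Equiv.Perm S)

/-! ## §3 The map-assisted star: the transported ratio -/

/-- **THE MAP-ASSISTED STAR RELAXES COLD REPLICA `k+1` NO FASTER THAN THE HOT REPLICA OFFERS THE PRE-IMAGE:** for
every `u`, `Gap(P^φ) ≤ (t·μ_0(u)/K + (1−t)·w_{k+1}·μ_{k+1}(φ_k u))/(μ_{k+1}(φ_k u)(1 − μ_{k+1}(φ_k u)))`. [ours] -/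
theorem flowStar_spectralGap_le_config [Nontrivial S] (hμ : ∀ k x, 0 < μ k x) (hμ1 : ∀ k, ∑ u, μ k u = 1)
    (hM : ∀ k, IsRowStochastic (M k)) (hMrev : ∀ k, DetailedBalance (μ k) (M k)) (hw0 : ∀ k, 0 ≤ w k)
    (hw1 : ∑ k, w k = 1) (ht0 : 0 ≤ t) (ht1 : t ≤ 1) (k : Fin K) (u : S) :
    spectralGap (tensorFun μ) (fun x y : Fin (K + 1) → S =>
        t * ptGraphSwap μ (fun k : Fin K => ((0 : Fin (K + 1)), k.succ)) φ x y + (1 - t) * prodKernel w M x y)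
      ≤ (t * μ 0 u / K + (1 - t) * w k.succ * μ k.succ (φ k u))
          / (μ k.succ (φ k u) * (1 - μ k.succ (φ k u))) := by
  rw [flowStar_spectralGap_eq φ hμ t w]
  set L : Fin (K + 1) → Equiv.Perm S := Fin.cons (Equiv.refl S) (fun k => (φ k).symm) with hL
  have hL0 : ∀ u, (L 0).symm u = u := fun u => by rw [hL, starLevel_zero]; rfl
  have hLs : ∀ (k : Fin K) (u : S), (L k.succ).symm u = φ k u := fun k u => by
    rw [hL, starLevel_succ, Equiv.symm_symm]
  have h := weightedStar_spectralGap_le_config (μ := fun i u => μ i ((L i).symm u))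
    (M := fun i u v => M i ((L i).symm u) ((L i).symm v)) (w := w) (t := t) (fun k u => hμ k _)
    (fun k => by rw [Equiv.sum_comp (L k).symm (μ k)]; exact hμ1 k) (fun k => ⟨fun u v => (hM k).1 _ _, fun u => ?_⟩)
    (fun k u v => hMrev k _ _) hw0 hw1 ht0 ht1 k u
  · simp only [hL0, hLs] at h
    exact h
  · simpa using (Equiv.sum_comp (L k).symm (fun v => M k ((L k).symm u) v)).trans ((hM k).2 _)

end FlowStarOffer

end Summit.Ventures.LatticeQCDFlow.Scaling

end
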